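import Summits.QuantumFields.YangMills.Theorems.UnitScaleTiltProp7FibreLevelSupLocalGauge
import Summits.QuantumFields.YangMills.Theorems.UnitScaleTiltProp7CurvedLandauKnitT3
import HarnessLib

/-!
# Route `UnitScaleTilt`, crux K1 «MinimiserStabilityRegPr» (stmt-QuantumFields-19200), route-R — THE FOUR SMALLNESS ROWS OF ✓ `Prop7FibreLevelSup` FROM ONE NUMBER on T³ ∕ `SU(2)`,
# and the two theorems of ✓ `Prop7FibreLevelSupLocalGauge` (fibre-level sup ∕ two-block mass `μ_j` from the plaquette bound) with the rows GONE

Cell `ym3-torus`, keyed width hand `ym-routeR-w1` gen 2 (D-0154 (3c); offer (d1) 2026-08-28 10:49Z to ★routeR-w3 g2's F3).  THEOREMS ONLY (0 `def`, 0 `sorry`);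
`--supports stmt-QuantumFields-19200`, count-neutral.  YM₃ on T³ is a ladder rung (R3), not the Clay problem; nothing here claims the stub, the crux, d = 4 or the mass gap.

THE POINT.  The every-`L` two-field theorem behind ✓ `Prop7FibreLevelSup` (★routeR-w3 s2) ∕ ✓ `Prop7FibreLevelSupLocalGauge` (this seat, ✓p624016) carries four displayed smallness
rows in the sizes `(ρ, η)` at level `j` (`hmδ`, `h200`, `hm`, `hNδ` — rational functions of `d`, `L` with the constants `18^d`, `324`, `5200`, `200`, `4` and the chart radius
`deltaSU n`).  On the cell's carrier (`d = 3`, `SU(2)`, `deltaSU (Fin 2) = 1∕3`) all four follow from the SINGLE inequality `2·10¹⁴·L·(4Lʲ(ρ + η)) ≤ 1` (§2; the binding row is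
`hm`, whose constant `4·18³(2 + 4·18³)·5200·(5L)²∕(L(L−1))` is `≤ 1.07·10¹⁴` for `L ≥ 3`).  §3 instantiates: the per-bond sup of the level-`j` ratio and the two-block mass `μ_j`
(the `hμ` binder of ✓p622368's fibre core, `μ_j = 240·L⁴·Lʲ·ρ`, cf. `mu_letter_T3`) from the (14)-type plaquette bound `dist1(U₀(∂p)) ≤ δ`, the competitor's sup `ρ` and one number.

WHAT IS PROVED (ns `…Theorems.Prop7FibreLevelSupRowsT3`).
* §2 ★ `rows_of_small` (the four rows VERBATIM at `P := F.P K`, `n := Fin 2`).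
* §3 ★★ `norm_pertVar_iter_le_of_plaqBound_T3` (`j < m+K`; number `2·10¹⁴L·(4Lʲ(ρ + 2·2Lʲδ)) ≤ 1`), ★★★ `twoBlockMass_le_of_plaqBound_T3` (`j+1 < m+K`; number
  `2·10¹⁴L·(4Lʲ(ρ + 2·3L^{j+1}δ)) ≤ 1`), `mu_letter_T3`.  With `δ = ε·ℓ⁻²`, `ρ = ε₂·ℓ⁻¹`, `ℓ = L^{K−n}`, `j + 1 ≤ K − n` the number reads `8·10¹⁴·(ε₂ + 6Lε·Lʲℓ⁻¹) ≤ 1`-type,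
  k-UNIFORM.
HONEST SCOPE.  Arithmetic + two instantiations; nothing of Bałaban's analysis is asserted.

References: T. Bałaban, CMP 98 (1985) 17–51 [Balaban1985Averaging] (Prop. 4 (134)–(135) p.38); CMP 109 (1987) 249–301 [Balaban1987RG1] ((0.4) p.253, (1.11)–(1.12) p.262).
-/

set_option autoImplicit false

noncomputable section

open scoped BigOperators Matrix.Norms.L2Operator

namespace Summit.QuantumFields.YangMills.Theorems.Prop7FibreLevelSupRowsT3

open Literature.MathematicalPhysics.QuantumFieldTheory.Balaban1983to89
open Literature.MathematicalPhysics.QuantumFieldTheory.Balaban1983to89.T3ContinuumYM3Torus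
open Finset BlockAveraging ExpMeanLog
open BlockAveragingEMLLinearisedBackground (pertVar)
open Summit.QuantumFields.YangMills.Theorems.Prop7FibreLevelSupLocalGauge (norm_pertVar_iter_le_of_plaqBound twoBlockMass_le_of_plaqBound)
open Summit.QuantumFields.YangMills.Theorems.Prop7CurvedLandauKnitT3 (three_le_L)

/-! ## §2 ★ The four rows from one number (`three_le_L` from ✓ `Prop7CurvedLandauKnitT3`) -/

/-- ★ **THE FOUR SMALLNESS ROWS OF ✓ `Prop7FibreLevelSup` ∕ ✓ `Prop7FibreLevelSupLocalGauge` FROM ONE NUMBER** (T³, `SU(2)`, level `j`, sizes `ρ, η ≥ 0`):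
`2·10¹⁴·L·(4Lʲ(ρ + η)) ≤ 1` implies `hmδ`, `h200`, `hm`, `hNδ` VERBATIM at `P := F.P K`, `n := Fin 2` (the binding row is `hm`: `4·18³(2+4·18³)·5200·(5L)²∕(L(L−1)) ≤ 1.07·10¹⁴` for `L ≥ 3`;
`deltaSU (Fin 2) = 1∕3`). [cite: Balaban1985Averaging, Prop. 4 (134)-(135) p.38] -/
theorem rows_of_small (F : T3Family) (K j : ℕ) {ρ η : ℝ} (hρ0 : 0 ≤ ρ) (hη0 : 0 ≤ η)
    (h : 2 * 10 ^ 14 * (F.L : ℝ) * (4 * (F.L : ℝ) ^ j * (ρ + η)) ≤ 1) :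
    ((((F.P K).d : ℝ) + 1) * ((18 : ℝ) ^ (F.P K).d * (2 + (((F.P K).d : ℝ) + 1) * (18 : ℝ) ^ (F.P K).d)) * (324 * ((((F.P K).d + 2) * (F.P K).L : ℕ) : ℝ) ^ 2) /
        (((F.P K).L : ℝ) * (((F.P K).L : ℝ) - 1))) * ((((F.P K).d : ℝ) + 1) * ((F.P K).L : ℝ) ^ j * η) ≤ 1 ∧
    200 * ((((F.P K).d + 2) * (F.P K).L : ℕ) : ℝ) * (((((F.P K).d : ℝ) + 1) * ((F.P K).L : ℝ) ^ j * ρ) + ((((F.P K).d : ℝ) + 1) * ((F.P K).L : ℝ) ^ j * η)) ≤ 1 ∧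
    ((((F.P K).d : ℝ) + 1) * ((18 : ℝ) ^ (F.P K).d * (2 + (((F.P K).d : ℝ) + 1) * (18 : ℝ) ^ (F.P K).d)) * (5200 * ((((F.P K).d + 2) * (F.P K).L : ℕ) : ℝ) ^ 2) /
        (((F.P K).L : ℝ) * (((F.P K).L : ℝ) - 1))) * (((((F.P K).d : ℝ) + 1) * ((F.P K).L : ℝ) ^ j * ρ) + ((((F.P K).d : ℝ) + 1) * ((F.P K).L : ℝ) ^ j * η)) ≤ 1 ∧
    4 * ((((F.P K).d + 2) * (F.P K).L : ℕ) : ℝ) * (((((F.P K).d : ℝ) + 1) * ((F.P K).L : ℝ) ^ j * ρ) + ((((F.P K).d : ℝ) + 1) * ((F.P K).L : ℝ) ^ j * η)) < deltaSU (Fin 2) := by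
  have hd : (F.P K).d = 3 := rfl
  have hLF : (F.P K).L = F.L := rfl
  have hL3 := three_le_L F
  set l : ℝ := (F.L : ℝ) with hl
  have hl0 : 0 < l := by linarith
  set X : ℝ := 4 * l ^ j * (ρ + η) with hX
  have hX0 : 0 ≤ X := by positivity
  have hE : ((3 : ℝ) + 1) * l ^ j * η ≤ X := by rw [hX]; nlinarith [pow_nonneg hl0.le j]
  have hRE : ((3 : ℝ) + 1) * l ^ j * ρ + ((3 : ℝ) + 1) * l ^ j * η = X := by rw [hX]; ring
  have hE0 : 0 ≤ ((3 : ℝ) + 1) * l ^ j * η := by positivity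
  have hLX : l * X ≤ 1 / (2 * 10 ^ 14) := by
    rw [le_div_iff₀ (by norm_num)]; linarith
  have hX1 : X ≤ 1 / (6 * 10 ^ 14) := by
    rw [le_div_iff₀ (by norm_num)]; nlinarith
  -- the quotient `L∕(L−1) ≤ 3∕2`
  have hden : 0 < l * (l - 1) := by nlinarith
  have hquot : ∀ {c y : ℝ}, 0 ≤ c → 0 ≤ y → c * (5 * l) ^ 2 / (l * (l - 1)) * y ≤ c * 25 * (3 / 2) * y := by
    intro c y hc hy
    have h1 : c * (5 * l) ^ 2 / (l * (l - 1)) ≤ c * 25 * (3 / 2) := by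
      rw [div_le_iff₀ hden]
      nlinarith [mul_nonneg hc hl0.le]
    exact mul_le_mul_of_nonneg_right h1 hy
  simp only [hd, hLF, ← hl]
  push_cast
  have hC : ((3 : ℝ) + 1) * ((18 : ℝ) ^ 3 * (2 + ((3 : ℝ) + 1) * (18 : ℝ) ^ 3)) = 544242240 := by norm_num
  refine ⟨?_, ?_, ?_, ?_⟩
  · -- hmδ
    rw [show ((3 : ℝ) + 1) * ((18 : ℝ) ^ 3 * (2 + ((3 : ℝ) + 1) * (18 : ℝ) ^ 3)) * (324 * (5 * l) ^ 2) / (l * (l - 1))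
        = (((3 : ℝ) + 1) * ((18 : ℝ) ^ 3 * (2 + ((3 : ℝ) + 1) * (18 : ℝ) ^ 3)) * 324) * (5 * l) ^ 2 / (l * (l - 1)) by ring]
    refine (hquot (by rw [hC]; norm_num) hE0).trans ?_
    rw [hC]
    nlinarith
  · -- h200
    rw [hRE]; nlinarith
  · -- hm
    rw [hRE, show ((3 : ℝ) + 1) * ((18 : ℝ) ^ 3 * (2 + ((3 : ℝ) + 1) * (18 : ℝ) ^ 3)) * (5200 * (5 * l) ^ 2) / (l * (l - 1))
        = (((3 : ℝ) + 1) * ((18 : ℝ) ^ 3 * (2 + ((3 : ℝ) + 1) * (18 : ℝ) ^ 3)) * 5200) * (5 * l) ^ 2 / (l * (l - 1)) by ring]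
    refine (hquot (by rw [hC]; norm_num) hX0).trans ?_
    rw [hC]
    nlinarith
  · -- hNδ : `deltaSU (Fin 2) = min (1∕3) (π∕2) = 1∕3` (as ✓ `AvgActionDefect.deltaSU_fin_two`, not imported)
    have hδ2 : deltaSU (Fin 2) = 1 / 3 := by
      unfold deltaSU
      rw [Fintype.card_fin]
      refine min_eq_left ?_
      have := Real.pi_gt_three
      push_cast
      linarith
    rw [hRE, hδ2]
    nlinarith


/-! ## §3 ★★ The two theorems of ✓ `Prop7FibreLevelSupLocalGauge` on T³ ∕ SU(2) with the rows GONE -/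

/-- ★★ **PER-BOND SUP OF THE LEVEL-`j` RATIO ON T³ FROM THE PLAQUETTE BOUND, THE COMPETITOR'S SUP AND ONE NUMBER**: `j < m + K`; `dist1(U₀(∂p)) ≤ δ`, `‖W_e − U₀,e‖ ≤ ρ`;
`2·10¹⁴·L·(4Lʲ(ρ + 2·2Lʲ·δ)) ≤ 1`.  THEN `‖pertVar Ū₀^{(j)} W̄^{(j)} (b)‖ ≤ 2·(4Lʲρ)`. [cite: Balaban1985Averaging, Prop. 4 (134)-(135) p.38; Balaban1987RG1, (1.11)-(1.12) p.262] -/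
theorem norm_pertVar_iter_le_of_plaqBound_T3 (F : T3Family) (K : ℕ) {j : ℕ} (hj : j < (F.P K).m + (F.P K).K) (b : PBond (F.P K) j)
    (W U₀ : GaugeField (F.P K) 0 (Matrix.specialUnitaryGroup (Fin 2) ℂ)) {ρ δ : ℝ} (hρ0 : 0 ≤ ρ) (hδ0 : 0 ≤ δ)
    (hU : ∀ p : Plaq (F.P K) 0, dist1 (GaugeField.plaqHol U₀ p) ≤ δ)
    (hρ : ∀ e : PBond (F.P K) 0, ‖((W e : Matrix.specialUnitaryGroup (Fin 2) ℂ) : Matrix (Fin 2) (Fin 2) ℂ) - ((U₀ e : Matrix.specialUnitaryGroup (Fin 2) ℂ) : Matrix (Fin 2) (Fin 2) ℂ)‖ ≤ ρ)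
    (h : 2 * 10 ^ 14 * (F.L : ℝ) * (4 * (F.L : ℝ) ^ j * (ρ + 2 * (2 * (F.L : ℝ) ^ j) * δ)) ≤ 1) :
    ‖pertVar (Averaging.iter (fun i => blockAvg (P := F.P K) (j := i) (expMeanLogSU (n := Fin 2))) j U₀)
        (Averaging.iter (fun i => blockAvg (P := F.P K) (j := i) (expMeanLogSU (n := Fin 2))) j W) b‖
      ≤ 2 * ((((F.P K).d : ℝ) + 1) * ((F.P K).L : ℝ) ^ j * ρ) := by
  have hη0 : 0 ≤ (((F.P K).d - 1 : ℕ) : ℝ) * (2 * ((F.P K).L : ℝ) ^ j) * δ := by positivity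
  have hη : (((F.P K).d - 1 : ℕ) : ℝ) * (2 * ((F.P K).L : ℝ) ^ j) * δ = 2 * (2 * (F.L : ℝ) ^ j) * δ := by
    rw [show (F.P K).d = 3 from rfl, show (F.P K).L = F.L from rfl]; norm_num
  obtain ⟨hmδ, h200, hm, hNδ⟩ := rows_of_small F K j hρ0 hη0 (by rw [hη]; exact h)
  exact norm_pertVar_iter_le_of_plaqBound hj b W U₀ hρ0 hδ0 hU hρ hmδ h200 hm hNδ

/-- ★★★ **THE TWO-BLOCK MASS `μ_j` ON T³ FROM THE PLAQUETTE BOUND, THE COMPETITOR'S SUP AND ONE NUMBER**: `j + 1 < m + K`; `dist1(U₀(∂p)) ≤ δ`, `‖W_e − U₀,e‖ ≤ ρ`;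
`2·10¹⁴·L·(4Lʲ(ρ + 2·3L^{j+1}·δ)) ≤ 1`.  THEN `(d+2)L·Σ_{b∈N(c)}‖pertVar Ū₀^{(j)} W̄^{(j)} b‖ ≤ (5L)·((6L³)·(2(4Lʲρ)))` — the `hμ` binder of ✓p622368's fibre core at
`μ_j := 240·L⁴·Lʲ·ρ` (letters as printed by the tree: `((d+2)L)·((2dL^d)·(2((d+1)Lʲρ)))`). [cite: Balaban1985Averaging, Prop. 4 (134)-(135) p.38; Balaban1987RG1, (0.4) p.253] -/
theorem twoBlockMass_le_of_plaqBound_T3 (F : T3Family) (K : ℕ) {j : ℕ} (hj : j + 1 < (F.P K).m + (F.P K).K) (c : PBond (F.P K) (j + 1))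
    (W U₀ : GaugeField (F.P K) 0 (Matrix.specialUnitaryGroup (Fin 2) ℂ)) {ρ δ : ℝ} (hρ0 : 0 ≤ ρ) (hδ0 : 0 ≤ δ)
    (hU : ∀ p : Plaq (F.P K) 0, dist1 (GaugeField.plaqHol U₀ p) ≤ δ)
    (hρ : ∀ e : PBond (F.P K) 0, ‖((W e : Matrix.specialUnitaryGroup (Fin 2) ℂ) : Matrix (Fin 2) (Fin 2) ℂ) - ((U₀ e : Matrix.specialUnitaryGroup (Fin 2) ℂ) : Matrix (Fin 2) (Fin 2) ℂ)‖ ≤ ρ)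
    (h : 2 * 10 ^ 14 * (F.L : ℝ) * (4 * (F.L : ℝ) ^ j * (ρ + 2 * (3 * (F.L : ℝ) ^ (j + 1)) * δ)) ≤ 1) :
    ((((F.P K).d + 2) * (F.P K).L : ℕ) : ℝ) * ∑ b ∈ (univ.filter (fun b : PBond (F.P K) j => blockOf b.src = c.src ∨ blockOf b.src = c.tgt)),
        ‖pertVar (Averaging.iter (fun i => blockAvg (P := F.P K) (j := i) (expMeanLogSU (n := Fin 2))) j U₀)
          (Averaging.iter (fun i => blockAvg (P := F.P K) (j := i) (expMeanLogSU (n := Fin 2))) j W) b‖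
      ≤ ((((F.P K).d + 2) * (F.P K).L : ℕ) : ℝ) * ((2 * (F.P K).d * ((F.P K).L : ℝ) ^ (F.P K).d) * (2 * ((((F.P K).d : ℝ) + 1) * ((F.P K).L : ℝ) ^ j * ρ))) := by
  have hη0 : 0 ≤ (((F.P K).d - 1 : ℕ) : ℝ) * (3 * ((F.P K).L : ℝ) ^ (j + 1)) * δ := by positivity
  have hη : (((F.P K).d - 1 : ℕ) : ℝ) * (3 * ((F.P K).L : ℝ) ^ (j + 1)) * δ = 2 * (3 * (F.L : ℝ) ^ (j + 1)) * δ := by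
    rw [show (F.P K).d = 3 from rfl, show (F.P K).L = F.L from rfl]; norm_num
  obtain ⟨hmδ, h200, hm, hNδ⟩ := rows_of_small F K j hρ0 hη0 (by rw [hη]; exact h)
  exact twoBlockMass_le_of_plaqBound hj c W U₀ hρ0 hδ0 hU hρ hmδ h200 hm hNδ

/-- The `μ_j` letter simplified: on T³ the right-hand side is `240·L⁴·Lʲ·ρ` times `(5L)`, i.e. `((d+2)L)·((2dL^d)·(2((d+1)Lʲρ))) = 5L·(48·L³·Lʲ·ρ)`; recorded as the
equality `(2·3·L³)·(2·(4·Lʲ·ρ)) = 48·L³·Lʲ·ρ` for consumers' arithmetic. [folklore] -/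
theorem mu_letter_T3 (F : T3Family) (K j : ℕ) (ρ : ℝ) :
    (2 * (F.P K).d * ((F.P K).L : ℝ) ^ (F.P K).d) * (2 * ((((F.P K).d : ℝ) + 1) * ((F.P K).L : ℝ) ^ j * ρ)) = 48 * (F.L : ℝ) ^ 3 * (F.L : ℝ) ^ j * ρ := by
  rw [show (F.P K).d = 3 from rfl, show (F.P K).L = F.L from rfl]; push_cast; ring

end Summit.QuantumFields.YangMills.Theorems.Prop7FibreLevelSupRowsT3

end
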